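import Mathlib

/-!
# Sketch — crux `WeakCouplingHypercubicLimit` (stmt-QuantumFields-16120), ideator 1, round 1

First lemmas of the crux idea `trace-norm-cold-pressure` ("un-gauge by the trace"):

* `TraceClusterBound` — the load-bearing REDUCTION, finite-dimensional form: for a positive
  operator `T` with a simple normalised top eigenvector `Ω` (`T Ω = Ω`) and second eigenvalue
  `≤ r ≤ 1`, the torus-type connected correlation `tr(T^a A T^b B)/tr(T^(a+b)) − ⟨A⟩⟨B⟩`
  of ANY two bounded operators is bounded by operator norms times
  `r^b (1 + X a) + r^a + 3 X (a+b)`, where `X m = tr T^m − 1` is the TRACE EXCESS (thermal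
  multiplicity).  With `T` the Osterwalder–Seiler transfer matrix of Wilson's theory on the
  spatial torus `(2S+1)^3`, `a + b = 2S+1`, `b = n ≤ S`, this is the clause of
  `HasLatticeMassGap` for the pair `(A, B)` with the constant `‖A‖∞ ‖B‖∞` — uniform in the pair,
  the volume and `k` — in terms of PARTITION FUNCTIONS only (`X m = Z(m × (2S+1)^3)/λ₊^m − 1`).
* `PressureForcesGap` — "`m → ∞` kills the volume": an exponential bound on the trace excess of
  normalised spectral data, `log(1 + Σ rᵢ^m) ≤ V·C·e^{-μ m}` for all large `m`, forces every
  normalised eigenvalue below `e^{-μ}`, whatever the (volume) prefactor `V`.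
Both are provable now (finite-dimensional spectral calculus / real analysis).
-/

namespace Summit.QuantumFields.YangMills.Cruxes.WeakCouplingHypercubicLimit.Ideator1

open scoped InnerProductSpace
open Finset

/-- **Trace cluster bound (reduction of the all-observable torus clustering clause to trace
excesses).**  `E` a finite-dimensional real Hilbert space, `T` positive with `T Ω = Ω`, `‖Ω‖ = 1`,
`‖T v‖ ≤ r ‖v‖` on `Ω^⊥` (`0 ≤ r ≤ 1`); `X m := tr T^m − 1 ≥ 0`.  For `b ≤ a`, `N = a + b`,
`Z = tr T^N = 1 + X N`:
`|tr(T^a A T^b B)/Z − (tr(T^N A)/Z)(tr(T^N B)/Z)| ≤ ‖A‖ ‖B‖ (r^b (1 + X a) + r^a + 3 X N)`.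
Proof sketch: `T^m = P_Ω + R^m` with `R = T(1 − P_Ω) ≥ 0`, `‖R‖ ≤ r`, `‖R^m‖₁ = X m`; expand the
four terms, use `|tr(P M)| ≤ ‖P‖₁ ‖M‖` and `|⟨Ω, M Ω⟩| ≤ ‖M‖`. -/
def TraceClusterBound : Prop :=
  ∀ (d : ℕ) (T A B : EuclideanSpace ℝ (Fin d) →L[ℝ] EuclideanSpace ℝ (Fin d))
    (Ω : EuclideanSpace ℝ (Fin d)) (r : ℝ) (a b : ℕ),
    T.IsPositive → ‖Ω‖ = 1 → T Ω = Ω → 0 ≤ r → r ≤ 1 →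
    (∀ v : EuclideanSpace ℝ (Fin d), ⟪Ω, v⟫_ℝ = 0 → ‖T v‖ ≤ r * ‖v‖) → b ≤ a →
    let tr : (EuclideanSpace ℝ (Fin d) →L[ℝ] EuclideanSpace ℝ (Fin d)) → ℝ :=
      fun M => LinearMap.trace ℝ (EuclideanSpace ℝ (Fin d)) (M : EuclideanSpace ℝ (Fin d) →ₗ[ℝ] EuclideanSpace ℝ (Fin d))
    let X : ℕ → ℝ := fun m => tr (T ^ m) - 1
    let Z : ℝ := tr (T ^ (a + b))
    |tr (T ^ a * A * T ^ b * B) / Z - (tr (T ^ (a + b) * A) / Z) * (tr (T ^ (a + b) * B) / Z)|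
      ≤ ‖A‖ * ‖B‖ * (r ^ b * (1 + X a) + r ^ a + 3 * X (a + b))

/-- **Pressure forces the gap ("`m → ∞` kills the volume").**  Normalised spectral data
`rᵢ ∈ [0, 1]` of a transfer matrix (top eigenvalue removed); if the trace excess obeys
`log(1 + Σᵢ rᵢ^m) ≤ V C e^{-μ m}` for all `m ≥ m₀` — a free-energy bound with an arbitrary
(volume) prefactor — then every `rᵢ ≤ e^{-μ}`: the spectral gap is at least `μ`. -/
def PressureForcesGap : Prop :=
  ∀ (n : ℕ) (r : Fin n → ℝ) (V C μ : ℝ) (m₀ : ℕ), (∀ i, 0 ≤ r i ∧ r i ≤ 1) → 0 < V →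
    (∀ m : ℕ, m₀ ≤ m → Real.log (1 + ∑ i, r i ^ m) ≤ V * C * Real.exp (-μ * m)) →
    ∀ i, r i ≤ Real.exp (-μ)

/-- The gap lemma, proved (elementary real analysis). -/
theorem pressureForcesGap : PressureForcesGap := by
  intro n r V C μ m₀ hr hV hP i
  by_contra hlt
  push Not at hlt
  -- `q := r i · e^{μ} > 1`
  have hexp : 0 < Real.exp (-μ) := Real.exp_pos _
  have hri : 0 < r i := lt_of_lt_of_le' hlt hexp.le |>.trans_le' le_rfl
  set q : ℝ := r i * Real.exp μ with hq
  have hq1 : 1 < q := by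
    have : Real.exp (-μ) * Real.exp μ = 1 := by rw [← Real.exp_add]; simp
    calc (1 : ℝ) = Real.exp (-μ) * Real.exp μ := this.symm
      _ < r i * Real.exp μ := by exact mul_lt_mul_of_pos_right hlt (Real.exp_pos μ)
  -- for `m ≥ m₀`: `r i ^ m ≤ log(1 + Σ) * ?`  — use `log (1 + x) ≥ x / (1 + x)` with `x = Σ ≤ n`
  have hsum_le : ∀ m : ℕ, ∑ j, r j ^ m ≤ n := fun m => by
    calc ∑ j, r j ^ m ≤ ∑ _j : Fin n, (1 : ℝ) :=
          Finset.sum_le_sum fun j _ => pow_le_one₀ (hr j).1 (hr j).2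
      _ = n := by simp
  have hkey : ∀ m : ℕ, m₀ ≤ m → q ^ m ≤ (n + 1) * (V * C) := by
    intro m hm
    have hS0 : 0 ≤ ∑ j, r j ^ m := Finset.sum_nonneg fun j _ => pow_nonneg (hr j).1 _
    have hlog := hP m hm
    -- `x/(1+x) ≤ log(1+x)` for `x ≥ 0`
    have hx : (∑ j, r j ^ m) / (1 + ∑ j, r j ^ m) ≤ Real.log (1 + ∑ j, r j ^ m) := by
      have h1 : 0 < 1 + ∑ j, r j ^ m := by linarith
      have := Real.add_one_le_exp (Real.log (1 + ∑ j, r j ^ m) - (∑ j, r j ^ m) / (1 + ∑ j, r j ^ m))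
      -- standard: log(1+x) ≥ x/(1+x); via `Real.log_le_sub_one_of_pos` applied to 1/(1+x)
      have h2 := Real.log_le_sub_one_of_pos (inv_pos.mpr h1)
      rw [Real.log_inv] at h2
      have h3 : (1 + ∑ j, r j ^ m)⁻¹ - 1 = -((∑ j, r j ^ m) / (1 + ∑ j, r j ^ m)) := by
        field_simp; ring
      linarith [h2, h3]
    have hrm : r i ^ m ≤ ∑ j, r j ^ m :=
      Finset.single_le_sum (f := fun j => r j ^ m) (fun j _ => pow_nonneg (hr j).1 _) (mem_univ i)
    have h1x : 1 + ∑ j, r j ^ m ≤ n + 1 := by linarith [hsum_le m]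
    have hpos : 0 < 1 + ∑ j, r j ^ m := by linarith
    -- r i ^ m ≤ (n+1) * log(1+Σ) ≤ (n+1) V C e^{-μ m}
    have hA : r i ^ m ≤ (n + 1) * (V * C * Real.exp (-μ * m)) := by
      have : (∑ j, r j ^ m) ≤ (1 + ∑ j, r j ^ m) * Real.log (1 + ∑ j, r j ^ m) := by
        have := (div_le_iff₀ hpos).mp hx
        linarith [this]
      have hlog0 : 0 ≤ Real.log (1 + ∑ j, r j ^ m) := Real.log_nonneg (by linarith)
      calc r i ^ m ≤ ∑ j, r j ^ m := hrm
        _ ≤ (1 + ∑ j, r j ^ m) * Real.log (1 + ∑ j, r j ^ m) := this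
        _ ≤ (n + 1) * Real.log (1 + ∑ j, r j ^ m) :=
            mul_le_mul_of_nonneg_right h1x hlog0
        _ ≤ (n + 1) * (V * C * Real.exp (-μ * m)) :=
            mul_le_mul_of_nonneg_left hlog (by positivity)
    -- multiply by e^{μ m}
    have hmul : r i ^ m * Real.exp (μ * m) ≤ (n + 1) * (V * C) := by
      have := mul_le_mul_of_nonneg_right hA (Real.exp_pos (μ * m)).le
      calc r i ^ m * Real.exp (μ * m) ≤ (n + 1) * (V * C * Real.exp (-μ * m)) * Real.exp (μ * m) := this
        _ = (n + 1) * (V * C) := by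
            rw [mul_assoc, mul_assoc, mul_assoc, ← Real.exp_add]; simp
    calc q ^ m = r i ^ m * Real.exp (μ * m) := by
          rw [hq, mul_pow, ← Real.exp_nat_mul, mul_comm (m : ℝ) μ]
      _ ≤ (n + 1) * (V * C) := hmul
  -- but `q ^ m → ∞`
  have htend : Filter.Tendsto (fun m : ℕ => q ^ m) Filter.atTop Filter.atTop :=
    tendsto_pow_atTop_atTop_of_one_lt hq1
  obtain ⟨m, hm⟩ := (Filter.tendsto_atTop_atTop.mp htend ((n + 1) * (V * C) + 1))
  have h := hm (max m m₀) (le_max_left _ _)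
  have h' := hkey (max m m₀) (le_max_right _ _)
  linarith

end Summit.QuantumFields.YangMills.Cruxes.WeakCouplingHypercubicLimit.Ideator1
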